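import Literature.MathematicalPhysics.KineticTheory.HardSphereFreeMeasureCovariance
import Literature.MathematicalPhysics.StatisticalMechanics.LowActivityHardSphereGibbsUniqueness
import Literature.MathematicalPhysics.KineticTheory.HardSphereGibbsGNZSandwich
import Mathlib.Analysis.Complex.ExponentialBounds

/-!
# Decorrelation of cube counts under the free hard-sphere box measure (line `FirstLemma`, crux stmt-AtomisticToContinuum-14135)

CORE helper file of the registered stub `c9_free_count_variance_le` (lead seat c9; piece (B2) of the thermodynamic step
of the Gibbs route of `stub_tangentEntropyBoundUniformGibbs`), namespace
`Summit.AtomisticToContinuum.HydrodynamicLimit.Theorems.KiferCompactification`; the variance bound itself is assembled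
in `…KiferFreeCountVariance.lean`.  No definitions: cubes, centres, count events and the free intensity are FILE-LOCAL
NOTATIONS for explicit terms (`c9v𝒬 k t = k + t𝟙 + [0,1)³`, `c9v𝒞 k t` its centre, `c9v𝒟 k k'` the lattice
sup-distance, `c9vℰ Q i = {i < N(Q × ℝ³)}`, `c9vν z β u = z · Leb ⊗ M_β(v-u)dv`).

For the FREE grand-canonical unit-diameter hard-sphere measure `γ_Λ(· | ∅)` of a bounded measurable region `Λ ⊆ ℝ³`
at activity `0 < z ≤ 1/64` (Poisson form `hsLocalSpec 1 (c9vν z β u) Λ ∅`; this IS `gibbsSpecMeasure 1 z β u Λ ∅`,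
`c9v_gibbsSpecMeasure_empty_eq_hsLocalSpec`) and two unit cubes `k + t𝟙 + [0,1)³`, `k' + t𝟙 + [0,1)³` of a common
lattice (ANYWHERE, in particular touching `∂Λ`), the count events `A = {i < N_k}`, `E = {j < N_{k'}}` satisfy the
summable covariance bound

  `|γ(A ∩ E) - γ(A) γ(E)| ≤ (3/2)^13 · (2/3)^{‖k - k'‖₁}`   (`c9_free_cube_count_cov_le`, stated in the
vocabulary `gibbsSpecMeasure` of the line, registered as a stub so that this helper file can land).

Mechanism (`c9v_abs_cov_le_centred`, `c9v_abs_cov_le_of_far`): the tree's decorrelation theorem for the free measure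
on a BALL (`abs_measureReal_inter_sub_mul_le`, Michelen–Perkins disagreement percolation: a local event over `B(0,1)`
and an event of the outside of `B(0,R)`, `1 + (d+2) ≤ R`, have covariance `≤ 2 · 2κe^κ(2κ)^d`) is stated for a GENERAL
intensity with mass `≤ κ` on unit-ball windows, `2κ < 1`.  The free measure on the box `Λ` is the free measure on any
ball `B(0,R') ⊇ Λ` for the intensity RESTRICTED to `Λ × ℝ³` (`c9v_hsLocalSpec_restrict_window_empty_eq`: the Poisson
sample has no point off `Λ × ℝ³`), and the restricted intensity inherits all hypotheses (`κ = 8z`, `16z ≤ 1/4`); the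
centre of the first cube is moved to the origin by the translation covariance of the free specification
(`hsLocalSpec_shift`).  So boundary cubes cost nothing extra.  With `d = ‖k-k'‖_∞ - 4` shells, `16z ≤ (2/3)³` and
`‖·‖₁ ≤ 3‖·‖_∞` the bound takes the product form above; for `‖k-k'‖_∞ ≤ 3` it is the trivial bound `1`.

Also here: measurability and separation of the cubes, and the PACKING bound `N_cube ≤ 8` for unit-hard-core
configurations (`c9v_count_window_cube_le`: one particle per half-cube of diameter `√3/2 < 1`).

References: M. Michelen, W. Perkins, arXiv:2109.01094, Thm 25 and §5; D. Ruelle, *Statistical Mechanics* (1969) §4.2;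
H.-O. Georgii, *Gibbs Measures and Phase Transitions* (2011), Def. 1.23.
-/

noncomputable section

open MeasureTheory ProbabilityTheory Set Filter Topology
open scoped ENNReal NNReal

namespace Summit.AtomisticToContinuum.HydrodynamicLimit.Theorems.KiferCompactification

open Literature.MathematicalPhysics.KineticTheory (V3 hsLocalSpec hsLocalSpec_def hsLocalSpec_shift glue_empty
  ae_restrict_eq_self isProbabilityMeasure_hsLocalSpec hsLocalSpec_ae_isHardCore hsLocalSpec_empty_ae_restrict_eq_self
  preimage_window shift_eq_translate abs_measureReal_inter_sub_mul_le window_mono measurableSet_preimage_add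
  isBounded_preimage_add)
open Literature.MathematicalPhysics.KineticTheory.HardSphereDLR (gibbsSpecMeasure gibbsSpecMeasure_apply)
open Literature.Analysis.FunctionSpaces (PointConfig maxwellianBeta IsPoissonPointProcess)
open Literature.MathematicalPhysics.StatisticalMechanics (hsLocalSpec_eq_gibbsSpec smul_prod_uniqueness_hypotheses
  smul_prod_map_add isProbabilityMeasure_withDensity_maxwellianBeta)
open Literature.MathematicalPhysics.StatisticalMechanics.HardSphere (Pos Phase window hardCoreSet glue poissonLaw shift
  IsHardCore isHardCore_empty measurableSet_window mem_window shift_empty measurable_shift)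

/-- File-local notation: the unit cube `k + t𝟙 + [0,1)³` of the lattice `ℕ³ + t𝟙` (`t ∈ ℝ`). -/
local notation3 (prettyPrint := false) "c9v𝒬 " k:max t:max =>
  ({x : V3 | ∀ i, x i ∈ Set.Ico ((k i : ℝ) + t) ((k i : ℝ) + t + 1)} : Set V3)

/-- File-local notation: the centre of the cube `c9v𝒬 k t`. -/
local notation3 (prettyPrint := false) "c9v𝒞 " k:max t:max => (WithLp.toLp 2 (fun i => (k i : ℝ) + t + 1 / 2) : V3)

/-- File-local notation: the lattice sup-distance `max_l |k_l - m_l|` of two cube labels. -/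
local notation3 (prettyPrint := false) "c9v𝒟 " k:max m:max => (Finset.univ.sup (fun l => (k l - m l) + (m l - k l)) : ℕ)

/-- File-local notation: the count event `{i < N(Q × ℝ³)}` ("more than `i` particles above `Q`"). -/
local notation3 (prettyPrint := false) "c9vℰ " Q:max i:max =>
  ((fun ω : PointConfig Phase => ω.count (window Q)) ⁻¹' Set.Ioi (i : ℕ∞))

/-- File-local notation: the one-particle intensity `z · Leb ⊗ M_β(v-u)dv` of the grand-canonical hard-sphere gas. -/
local notation3 (prettyPrint := false) "c9vν " z:max β:max u:max =>
  (((Real.toNNReal z) • ((volume : Measure Pos).prod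
    ((volume : Measure Pos).withDensity fun v => ENNReal.ofReal (maxwellianBeta β (v - u))))) : Measure Phase)

/-! ## Unit cubes, count events, packing -/

/-- Unit cubes are measurable. -/
theorem c9v_measurableSet_cube (k : Fin 3 → ℕ) (t : ℝ) : MeasurableSet (c9v𝒬 k t) := by
  have h : c9v𝒬 k t = ⋂ i, (fun y : V3 => y i) ⁻¹' Ico ((k i : ℝ) + t) ((k i : ℝ) + t + 1) := by
    ext y
    simp
  rw [h]
  exact MeasurableSet.iInter fun i => measurableSet_Ico.preimage (by fun_prop)

/-- The unit cube recentred at its centre lies in the open unit ball (its half-diagonal is `√3/2 < 1`). -/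
theorem c9v_preimage_add_centre_subset_ball (k : Fin 3 → ℕ) (t : ℝ) :
    (fun x : V3 => x + c9v𝒞 k t) ⁻¹' c9v𝒬 k t ⊆ Metric.ball 0 1 := by
  intro x hx
  rw [mem_preimage] at hx
  rw [Metric.mem_ball, dist_zero_right, EuclideanSpace.norm_eq]
  have hc : ∀ i, ‖x i‖ ^ 2 ≤ 1 / 4 := fun i => by
    have h := hx i
    simp only [PiLp.add_apply, mem_Ico] at h
    rw [Real.norm_eq_abs, sq_abs]
    nlinarith [h.1, h.2]
  have hsum : ∑ i, ‖x i‖ ^ 2 ≤ 3 / 4 := by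
    rw [Fin.sum_univ_three]; linarith [hc 0, hc 1, hc 2]
  calc Real.sqrt (∑ i, ‖x i‖ ^ 2) ≤ Real.sqrt (3 / 4) := Real.sqrt_le_sqrt hsum
    _ < 1 := by
      rw [show (1 : ℝ) = Real.sqrt 1 from Real.sqrt_one.symm]
      exact Real.sqrt_lt_sqrt (by norm_num) (by norm_num)

/-- The `ℓ¹` lattice distance is at most three times the sup-distance. -/
theorem c9v_sum_le_three_mul_dist (k k' : Fin 3 → ℕ) :
    ∑ l, ((k l - k' l) + (k' l - k l)) ≤ 3 * c9v𝒟 k k' := by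
  have h := Finset.sum_le_card_nsmul (Finset.univ : Finset (Fin 3)) (fun l => (k l - k' l) + (k' l - k l))
    (c9v𝒟 k k') fun l _ => Finset.le_sup (f := fun l => (k l - k' l) + (k' l - k l)) (Finset.mem_univ l)
  rwa [Finset.card_univ, Fintype.card_fin, smul_eq_mul] at h

/-- **Separation of distant cubes**: seen from the centre of the cube with label `k`, the cube with label `k'`
(same lattice, offset `t`) lies outside the open ball of radius `max_l |k_l - k'_l| - 1/2`. -/
theorem c9v_preimage_add_centre_subset_compl_ball (t : ℝ) (k k' : Fin 3 → ℕ) :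
    (fun x : V3 => x + c9v𝒞 k t) ⁻¹' c9v𝒬 k' t ⊆
      (Metric.ball (0 : V3) ((c9v𝒟 k k' : ℝ) - 1 / 2))ᶜ := by
  intro x hx
  rw [mem_preimage] at hx
  obtain ⟨i, -, hi⟩ := Finset.exists_mem_eq_sup (Finset.univ : Finset (Fin 3)) Finset.univ_nonempty
    (fun l => (k l - k' l) + (k' l - k l))
  rw [mem_compl_iff, Metric.mem_ball, dist_zero_right, not_lt]
  have hxi := hx i
  simp only [PiLp.add_apply, mem_Ico] at hxi
  have hcoord : (c9v𝒟 k k' : ℝ) - 1 / 2 ≤ |x i| := by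
    rw [hi]
    rcases le_total (k i) (k' i) with hkk | hkk
    · rw [Nat.sub_eq_zero_of_le hkk, zero_add, Nat.cast_sub hkk, le_abs]
      left; linarith [hxi.1]
    · rw [Nat.sub_eq_zero_of_le hkk, add_zero, Nat.cast_sub hkk, le_abs]
      right; linarith [hxi.2]
  calc (c9v𝒟 k k' : ℝ) - 1 / 2 ≤ |x i| := hcoord
    _ = ‖x i‖ := (Real.norm_eq_abs _).symm
    _ ≤ ‖x‖ := PiLp.norm_apply_le x i

/-- Count events of measurable regions are measurable. -/
theorem c9v_measurableSet_countEvent {Q : Set V3} (hQ : MeasurableSet Q) (i : ℕ) : MeasurableSet (c9vℰ Q i) :=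
  PointConfig.measurable_count (measurableSet_window hQ) MeasurableSet.of_discrete

/-- Two points of the same unit cube lying in the same half along every axis are at distance `< 1`. -/
theorem c9v_dist_lt_one_of_same_halves {k : Fin 3 → ℕ} {t : ℝ} {p q : V3} (hp : p ∈ c9v𝒬 k t) (hq : q ∈ c9v𝒬 k t)
    (h : ∀ i, ((k i : ℝ) + t + 1 / 2 ≤ p i ↔ (k i : ℝ) + t + 1 / 2 ≤ q i)) : dist p q < 1 := by
  have hc : ∀ i, dist (p i) (q i) ^ 2 ≤ 1 / 4 := fun i => by
    have hpi := hp i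
    have hqi := hq i
    have hi := h i
    rw [mem_Ico] at hpi hqi
    have habs : |p i - q i| ≤ 1 / 2 := by
      rw [abs_le]
      by_cases hle : (k i : ℝ) + t + 1 / 2 ≤ p i
      · have := hi.1 hle
        constructor <;> linarith
      · have hq' : ¬ (k i : ℝ) + t + 1 / 2 ≤ q i := fun h' => hle (hi.2 h')
        push Not at hle hq'
        constructor <;> linarith
    rw [Real.dist_eq]
    nlinarith [abs_nonneg (p i - q i), sq_abs (p i - q i)]
  rw [EuclideanSpace.dist_eq]
  have hsum : ∑ i, dist (p i) (q i) ^ 2 ≤ 3 / 4 := by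
    rw [Fin.sum_univ_three]; linarith [hc 0, hc 1, hc 2]
  calc Real.sqrt (∑ i, dist (p i) (q i) ^ 2) ≤ Real.sqrt (3 / 4) := Real.sqrt_le_sqrt hsum
    _ < 1 := by
      rw [show (1 : ℝ) = Real.sqrt 1 from Real.sqrt_one.symm]
      exact Real.sqrt_lt_sqrt (by norm_num) (by norm_num)

/-- **Packing**: a unit-hard-core configuration has at most `8` particles above a unit cube (at most one in each
of the eight half-cubes, whose diameter is `√3/2 < 1`). -/
theorem c9v_count_window_cube_le {ω : PointConfig Phase} (hω : IsHardCore 1 ω) (k : Fin 3 → ℕ) (t : ℝ) :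
    ω.count (window (c9v𝒬 k t)) ≤ ((8 : ℕ) : ℕ∞) := by
  classical
  set S : Set Phase := ω.carrier ∩ window (c9v𝒬 k t) with hS
  set f : Phase → (Fin 3 → Bool) := fun p i => decide ((k i : ℝ) + t + 1 / 2 ≤ p.1 i) with hf
  have hinj : InjOn f S := by
    intro p hp q hq hpq
    by_contra hne
    have hd := hω p hp.1 q hq.1 hne
    have hlt : dist p.1 q.1 < 1 := by
      refine c9v_dist_lt_one_of_same_halves (mem_window.1 hp.2) (mem_window.1 hq.2) fun i => ?_
      have := congr_fun hpq i
      simpa [hf] using this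
    linarith
  calc ω.count (window (c9v𝒬 k t)) = S.encard := rfl
    _ = (f '' S).encard := (hinj.encard_image).symm
    _ ≤ (univ : Set (Fin 3 → Bool)).encard := encard_le_encard (subset_univ _)
    _ = ((8 : ℕ) : ℕ∞) := by
      rw [encard_univ, ENat.card_eq_coe_fintype_card]; rfl

/-! ## Covariances under the free box measure -/

/-- A covariance of two events is at most `1` in absolute value. -/
theorem c9v_abs_cov_le_one {Ω : Type*} [MeasurableSpace Ω] (P : Measure Ω)
    [IsProbabilityMeasure P] (A B : Set Ω) : |P.real (A ∩ B) - P.real A * P.real B| ≤ 1 := by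
  have h1 : P.real (A ∩ B) ≤ 1 := measureReal_le_one
  have h2 : 0 ≤ P.real (A ∩ B) := measureReal_nonneg
  have h3 : P.real A * P.real B ≤ 1 := mul_le_one₀ measureReal_le_one measureReal_nonneg measureReal_le_one
  have h4 : 0 ≤ P.real A * P.real B := mul_nonneg measureReal_nonneg measureReal_nonneg
  rw [abs_le]
  constructor <;> linarith

/-! ## The free measure: identification, restriction of the intensity, translation, decorrelation -/

/-- The free intensity is locally finite. -/
theorem c9v_isLocallyFiniteMeasure_intensity (z : ℝ) {β : ℝ} (hβ : 0 < β) (u : V3) :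
    IsLocallyFiniteMeasure (c9vν z β u) := by
  haveI := isProbabilityMeasure_withDensity_maxwellianBeta hβ u
  infer_instance

/-- The hypotheses of the tree's decorrelation machinery for the free intensity at `0 < z ≤ 1/64`: atomless, no
mass on the hyperplanes `{q₀ = t}`, mass `≤ 8z` on unit-ball windows, finite on ball windows. -/
theorem c9v_intensity_hypotheses {z β : ℝ} (hz : 0 < z) (hz1 : z ≤ 1 / 64) (hβ : 0 < β) (u : V3) :
    (∀ x, (c9vν z β u) {x} = 0) ∧ (∀ t : ℝ, (c9vν z β u) {y : Phase | y.1 0 = t} = 0) ∧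
      (∀ a : Pos, (c9vν z β u) (window (Metric.ball a 1)) ≤ ENNReal.ofReal (8 * z)) ∧
      (∀ R : ℝ, (c9vν z β u) (window (Metric.ball (0 : Pos) R)) ≠ ∞) := by
  obtain ⟨h0, hm, -, hκ, -, hfin⟩ := smul_prod_uniqueness_hypotheses (σ := 1) one_pos hz.le (by nlinarith) hβ u
  refine ⟨h0, hm, fun a => ?_, hfin⟩
  have h := hκ a
  rwa [one_pow, mul_one] at h

/-- **The free box measure in the two vocabularies**: the specification-as-a-measure with empty boundary condition
`gibbsSpecMeasure 1 z β u Λ ∅` is the Poisson-form free distribution `hsLocalSpec 1 (z · Leb ⊗ M) Λ ∅`. -/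
theorem c9v_gibbsSpecMeasure_empty_eq_hsLocalSpec {z β : ℝ} (hz : 0 ≤ z) (hβ : 0 < β) (u : V3) {Λ : Set V3}
    (hΛ : MeasurableSet Λ) (hb : Bornology.IsBounded Λ) :
    gibbsSpecMeasure 1 z β u Λ ∅ = hsLocalSpec 1 (c9vν z β u) Λ ∅ := by
  refine Measure.ext fun A hA => ?_
  rw [gibbsSpecMeasure_apply 1 z β u hΛ ∅ hA]
  exact (hsLocalSpec_eq_gibbsSpec u hz hβ hΛ hb (isHardCore_empty 1) hA).symm

/-- **The free distribution only sees the intensity on its window**: for `Λ ⊆ D`, the free distribution in `D` of the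
intensity restricted to `Λ × ℝ³` is the free distribution in `Λ` (the Poisson sample has no point off `Λ × ℝ³`). -/
theorem c9v_hsLocalSpec_restrict_window_empty_eq (ν : Measure Phase) [IsLocallyFiniteMeasure ν] (h0 : ∀ x, ν {x} = 0)
    (σ : ℝ) {Λ D : Set Pos} (hΛ : MeasurableSet Λ) (hΛD : Λ ⊆ D) :
    hsLocalSpec σ (ν.restrict (window Λ)) D ∅ = hsLocalSpec σ ν Λ ∅ := by
  have hWΛ : MeasurableSet (window Λ) := measurableSet_window hΛ
  have hsub : window Λ ⊆ window D := window_mono hΛD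
  have hrestr : (ν.restrict (window Λ)).restrict (window D) = ν.restrict (window Λ) := by
    rw [Measure.restrict_restrict' hWΛ, inter_eq_right.2 hsub]
  have hmap : (poissonLaw (ν.restrict (window Λ))).map (glue D ∅) =
      (poissonLaw (ν.restrict (window Λ))).map (glue Λ ∅) := by
    refine Measure.map_congr ?_
    filter_upwards [ae_restrict_eq_self ν h0 hWΛ] with ζ hζ
    rw [glue_empty, glue_empty, hζ]
    refine PointConfig.ext fun x => ⟨fun hx => hx.1, fun hx => ⟨hx, hsub ?_⟩⟩
    rw [← hζ] at hx
    exact hx.2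
  rw [hsLocalSpec_def, hsLocalSpec_def, hrestr, hmap]

/-- **Decorrelation of count events, centred form.** For an intensity `ν` satisfying the hypotheses of the tree's
covariance bound (`abs_measureReal_inter_sub_mul_le`), a measurable region `D ⊆ B(0, R')`, a region `Q₀ ⊆ B(0,1)`
and a region `Q₁` outside `B(0, R)`, `1 + (d+2) ≤ R ≤ R'`, the count events of `Q₀` and `Q₁` have covariance at
most `2 · 2κ e^κ (2κ)^d` under the free distribution in `D` (which is the free distribution in `B(0,R')` of the
intensity restricted to `D × ℝ³`). -/
theorem c9v_abs_cov_le_centred (ν : Measure Phase) [IsLocallyFiniteMeasure ν] (h0 : ∀ x, ν {x} = 0)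
    (hm : ∀ t : ℝ, ν {y : Phase | y.1 0 = t} = 0) {κ : ℝ} (hκ0 : 0 ≤ κ)
    (hκ : ∀ a : Pos, ν (window (Metric.ball a 1)) ≤ ENNReal.ofReal κ)
    (hfin : ∀ R : ℝ, ν (window (Metric.ball (0 : Pos) R)) ≠ ∞)
    {D : Set Pos} (hD : MeasurableSet D) {R R' : ℝ} (hDR' : D ⊆ Metric.ball 0 R') (hRR' : R ≤ R')
    {Q₀ Q₁ : Set Pos} (hQ₀ : MeasurableSet Q₀) (hQ₁ : MeasurableSet Q₁) (hQ₀b : Q₀ ⊆ Metric.ball 0 1)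
    (hQ₁b : Q₁ ⊆ (Metric.ball 0 R)ᶜ) {d : ℕ} (hR : 1 + ((d : ℝ) + 2) ≤ R) (i j : ℕ) :
    |(hsLocalSpec 1 ν D ∅).real (c9vℰ Q₀ i ∩ c9vℰ Q₁ j) -
        (hsLocalSpec 1 ν D ∅).real (c9vℰ Q₀ i) * (hsLocalSpec 1 ν D ∅).real (c9vℰ Q₁ j)| ≤
      2 * (2 * κ * Real.exp κ * (2 * κ) ^ d) := by
  set ν' := ν.restrict (window D) with hν'
  have hle : ∀ s, ν' s ≤ ν s := fun s => Measure.restrict_apply_le _ _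
  have h0' : ∀ x, ν' {x} = 0 := fun x => nonpos_iff_eq_zero.1 ((hle _).trans_eq (h0 x))
  have hm' : ∀ t : ℝ, ν' {y : Phase | y.1 0 = t} = 0 := fun t => nonpos_iff_eq_zero.1 ((hle _).trans_eq (hm t))
  have hκ' : ∀ a : Pos, ν' (window (Metric.ball a 1)) ≤ ENNReal.ofReal κ := fun a => (hle _).trans (hκ a)
  have hfin' : ∀ R : ℝ, ν' (window (Metric.ball (0 : Pos) R)) ≠ ∞ := fun R =>
    ne_top_of_le_ne_top (hfin R) (hle _)
  have hPeq : hsLocalSpec 1 ν D ∅ = hsLocalSpec 1 ν' (Metric.ball 0 R') ∅ :=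
    (c9v_hsLocalSpec_restrict_window_empty_eq ν h0 1 hD hDR').symm
  have hR1 : (1 : ℝ) + (d + 2) * 1 ≤ R := by rwa [mul_one]
  have hcov := abs_measureReal_inter_sub_mul_le ν' one_pos h0' hm' hκ0 hκ' hfin' hR1 hRR'
    (c9v_measurableSet_countEvent hQ₀ i) (c9v_measurableSet_countEvent hQ₁ j)
  have hA : PointConfig.restrict (window (Metric.ball (0 : Pos) 1)) ⁻¹' c9vℰ Q₀ i = c9vℰ Q₀ i := by
    ext ω
    simp only [mem_preimage, mem_Ioi, PointConfig.count_restrict, inter_eq_right.2 (window_mono hQ₀b)]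
  have hsubE : window Q₁ ⊆ (window (Metric.ball (0 : Pos) R))ᶜ := fun y hy => by
    rw [mem_compl_iff, mem_window]
    exact hQ₁b (mem_window.1 hy)
  have hE : PointConfig.restrict (window (Metric.ball (0 : Pos) R))ᶜ ⁻¹' c9vℰ Q₁ j = c9vℰ Q₁ j := by
    ext ω
    simp only [mem_preimage, mem_Ioi, PointConfig.count_restrict, inter_eq_right.2 hsubE]
  rw [hA, hE] at hcov
  rw [hPeq]
  refine hcov.trans ?_
  haveI : IsProbabilityMeasure (hsLocalSpec 1 ν' (Metric.ball 0 R') ∅) :=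
    isProbabilityMeasure_hsLocalSpec ν' h0' Metric.isOpen_ball.measurableSet (hfin' R')
      ((isHardCore_empty 1).restrict _)
  have hνk : ν'.real (window (Metric.ball (0 : Pos) 1)) ≤ κ := ENNReal.toReal_le_of_le_ofReal hκ0 (hκ' 0)
  have hP1 : (hsLocalSpec 1 ν' (Metric.ball 0 R') ∅).real (c9vℰ Q₁ j) ≤ 1 := measureReal_le_one
  have hν0 : 0 ≤ ν'.real (window (Metric.ball (0 : Pos) 1)) := measureReal_nonneg
  calc 2 * (2 * ν'.real (window (Metric.ball (0 : Pos) 1)) * Real.exp (ν'.real (window (Metric.ball (0 : Pos) 1))) *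
        (2 * κ) ^ d) * (hsLocalSpec 1 ν' (Metric.ball 0 R') ∅).real (c9vℰ Q₁ j)
      ≤ 2 * (2 * κ * Real.exp κ * (2 * κ) ^ d) * 1 := by gcongr
    _ = 2 * (2 * κ * Real.exp κ * (2 * κ) ^ d) := mul_one _

/-- **Decorrelation of count events under the free box measure** (any bounded measurable box `Λ`, cubes anywhere):
if, seen from the point `c`, the region `Q` lies in `B(0,1)` and the region `Q'` outside `B(0,R)` with
`1 + (d+2) ≤ R`, then the count events of `Q` and `Q'` have covariance at most `2 · 2(8z) e^{8z} (16z)^d` under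
`γ_Λ(· | ∅)` — translate `c` to the origin (translation covariance of the free specification) and apply the centred
form to the translated box. -/
theorem c9v_abs_cov_le_of_far {z β : ℝ} (hz : 0 < z) (hz1 : z ≤ 1 / 64) (hβ : 0 < β) (u : V3)
    {Λ : Set V3} (hΛ : MeasurableSet Λ) (hb : Bornology.IsBounded Λ) (c : V3)
    {Q Q' : Set V3} (hQ : MeasurableSet Q) (hQ' : MeasurableSet Q')
    (hQc : (fun x => x + c) ⁻¹' Q ⊆ Metric.ball 0 1) {R : ℝ} (hQ'c : (fun x => x + c) ⁻¹' Q' ⊆ (Metric.ball 0 R)ᶜ)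
    {d : ℕ} (hR : 1 + ((d : ℝ) + 2) ≤ R) (i j : ℕ) :
    |(hsLocalSpec 1 (c9vν z β u) Λ ∅).real (c9vℰ Q i ∩ c9vℰ Q' j) -
        (hsLocalSpec 1 (c9vν z β u) Λ ∅).real (c9vℰ Q i) *
          (hsLocalSpec 1 (c9vν z β u) Λ ∅).real (c9vℰ Q' j)| ≤
      2 * (2 * (8 * z) * Real.exp (8 * z) * (2 * (8 * z)) ^ d) := by
  haveI := c9v_isLocallyFiniteMeasure_intensity z hβ u
  obtain ⟨h0, hm, hκ, hfin⟩ := c9v_intensity_hypotheses hz hz1 hβ u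
  have hshift : hsLocalSpec 1 (c9vν z β u) Λ ∅ =
      (hsLocalSpec 1 (c9vν z β u) ((· + c) ⁻¹' Λ) ∅).map (shift c) := by
    have h := hsLocalSpec_shift (a := c) (σ := 1) h0 (smul_prod_map_add z _ c) hΛ (∅ : PointConfig Phase)
    rwa [shift_empty] at h
  have hpre : ∀ (S : Set V3) (i : ℕ), shift c ⁻¹' c9vℰ S i = c9vℰ ((· + c) ⁻¹' S) i := fun S i => by
    ext ω
    simp only [mem_preimage, mem_Ioi, shift_eq_translate, PointConfig.count_translate, preimage_window]
  have hmS := measurable_shift c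
  have hDm : MeasurableSet ((· + c) ⁻¹' Λ) := measurableSet_preimage_add c hΛ
  obtain ⟨R', hRR', hDR'⟩ := (isBounded_preimage_add c hb).subset_ball_lt R 0
  rw [hshift, map_measureReal_apply hmS ((c9v_measurableSet_countEvent hQ i).inter (c9v_measurableSet_countEvent hQ' j)),
    map_measureReal_apply hmS (c9v_measurableSet_countEvent hQ i),
    map_measureReal_apply hmS (c9v_measurableSet_countEvent hQ' j), preimage_inter, hpre, hpre]
  exact c9v_abs_cov_le_centred _ h0 hm (by positivity) hκ hfin hDm hDR' hRR'.le
    (measurableSet_preimage_add c hQ) (measurableSet_preimage_add c hQ') hQc hQ'c hR i j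

/-- **Covariance bound for the count events of two unit cubes of a common lattice under the free box measure**
(registered form, vocabulary of the line: `gibbsSpecMeasure 1 z β u Λ ∅` for ANY bounded measurable `Λ`, cubes
`k + t𝟙 + [0,1)³`, `k' + t𝟙 + [0,1)³` anywhere, events `{i < N(cube × ℝ³)}`), summable in the partner cube:
`|γ(A ∩ E) - γ(A) γ(E)| ≤ (3/2)^13 · (2/3)^{‖k - k'‖₁}` for `0 < z ≤ 1/64` — the decorrelation bound with
`d = ‖k-k'‖_∞ - 4` shells (`16 z ≤ (2/3)³`, `‖·‖₁ ≤ 3‖·‖_∞`) when `‖k-k'‖_∞ ≥ 4`, the trivial bound `1` otherwise. -/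
theorem c9_free_cube_count_cov_le {z β : ℝ} {u : V3} (hz : 0 < z) (hz1 : z ≤ 1 / 64) (hβ : 0 < β) {Λ : Set V3}
    (hΛ : MeasurableSet Λ) (hb : Bornology.IsBounded Λ) (t : ℝ) (k k' : Fin 3 → ℕ) (i j : ℕ) :
    |(gibbsSpecMeasure 1 z β u Λ ∅).real
          ({ω | (i : ℕ∞) < ω.count ({x : V3 | ∀ l, x l ∈ Ico ((k l : ℝ) + t) ((k l : ℝ) + t + 1)} ×ˢ univ)} ∩
            {ω | (j : ℕ∞) < ω.count ({x : V3 | ∀ l, x l ∈ Ico ((k' l : ℝ) + t) ((k' l : ℝ) + t + 1)} ×ˢ univ)}) -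
        (gibbsSpecMeasure 1 z β u Λ ∅).real
            {ω | (i : ℕ∞) < ω.count ({x : V3 | ∀ l, x l ∈ Ico ((k l : ℝ) + t) ((k l : ℝ) + t + 1)} ×ˢ univ)} *
          (gibbsSpecMeasure 1 z β u Λ ∅).real
            {ω | (j : ℕ∞) < ω.count ({x : V3 | ∀ l, x l ∈ Ico ((k' l : ℝ) + t) ((k' l : ℝ) + t + 1)} ×ˢ univ)}| ≤
      (3 / 2) ^ 13 * (2 / 3) ^ (∑ l, ((k l - k' l) + (k' l - k l))) := by
  haveI := c9v_isLocallyFiniteMeasure_intensity z hβ u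
  obtain ⟨h0, -, -, hfin⟩ := c9v_intensity_hypotheses hz hz1 hβ u
  obtain ⟨R₀, hR₀⟩ := hb.subset_ball 0
  rw [c9v_gibbsSpecMeasure_empty_eq_hsLocalSpec hz.le hβ u hΛ hb]
  haveI : IsProbabilityMeasure (hsLocalSpec 1 (c9vν z β u) Λ ∅) :=
    isProbabilityMeasure_hsLocalSpec _ h0 hΛ (ne_top_of_le_ne_top (hfin R₀) (measure_mono (window_mono hR₀)))
      ((isHardCore_empty 1).restrict _)
  change |(hsLocalSpec 1 (c9vν z β u) Λ ∅).real (c9vℰ (c9v𝒬 k t) i ∩ c9vℰ (c9v𝒬 k' t) j) -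
      (hsLocalSpec 1 (c9vν z β u) Λ ∅).real (c9vℰ (c9v𝒬 k t) i) *
        (hsLocalSpec 1 (c9vν z β u) Λ ∅).real (c9vℰ (c9v𝒬 k' t) j)| ≤ _
  set r := c9v𝒟 k k' with hr
  set s := ∑ l, ((k l - k' l) + (k' l - k l)) with hs
  have hs3 : s ≤ 3 * r := c9v_sum_le_three_mul_dist k k'
  by_cases h4 : 4 ≤ r
  · have hR : 1 + (((r - 4 : ℕ) : ℝ) + 2) ≤ (r : ℝ) - 1 / 2 := by
      rw [Nat.cast_sub h4]; push_cast; linarith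
    have hcov := c9v_abs_cov_le_of_far hz hz1 hβ u hΛ hb (c9v𝒞 k t) (c9v_measurableSet_cube k t)
      (c9v_measurableSet_cube k' t) (c9v_preimage_add_centre_subset_ball k t)
      (c9v_preimage_add_centre_subset_compl_ball t k k') hR i j
    refine hcov.trans ?_
    have h1 : ((2 : ℝ) / 3) ^ (3 * r) ≤ (2 / 3) ^ s := pow_le_pow_of_le_one (by norm_num) (by norm_num) hs3
    have h2 : ((3 : ℝ) / 2) ^ 13 * (2 / 3) ^ (3 * r) = 3 / 2 * (2 / 3) ^ (3 * r - 12) := by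
      have h' : 3 * r = (3 * r - 12) + 12 := by omega
      rw [h', pow_add, Nat.add_sub_cancel]
      ring
    have h3 : (2 * (8 * z)) ^ (r - 4) ≤ ((2 : ℝ) / 3) ^ (3 * r - 12) := by
      rw [show 3 * r - 12 = 3 * (r - 4) by omega, pow_mul]
      exact pow_le_pow_left₀ (by positivity) (by nlinarith) _
    have h5 : 2 * (2 * (8 * z) * Real.exp (8 * z)) ≤ 3 / 2 := by
      have he : Real.exp (8 * z) ≤ 3 :=
        (Real.exp_le_exp.2 (by linarith : 8 * z ≤ 1)).trans Real.exp_one_lt_three.le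
      nlinarith [Real.exp_pos (8 * z)]
    calc 2 * (2 * (8 * z) * Real.exp (8 * z) * (2 * (8 * z)) ^ (r - 4))
        = 2 * (2 * (8 * z) * Real.exp (8 * z)) * (2 * (8 * z)) ^ (r - 4) := by ring
      _ ≤ 3 / 2 * (2 / 3) ^ (3 * r - 12) := mul_le_mul h5 h3 (by positivity) (by norm_num)
      _ = (3 / 2) ^ 13 * (2 / 3) ^ (3 * r) := h2.symm
      _ ≤ (3 / 2) ^ 13 * (2 / 3) ^ s := mul_le_mul_of_nonneg_left h1 (by positivity)
  · have hs9 : s ≤ 9 := by omega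
    have h1 : ((2 : ℝ) / 3) ^ 9 ≤ (2 / 3) ^ s := pow_le_pow_of_le_one (by norm_num) (by norm_num) hs9
    calc _ ≤ (1 : ℝ) := c9v_abs_cov_le_one _ _ _
      _ ≤ (3 / 2) ^ 13 * (2 / 3) ^ 9 := by norm_num
      _ ≤ (3 / 2) ^ 13 * (2 / 3) ^ s := mul_le_mul_of_nonneg_left h1 (by positivity)

end Summit.AtomisticToContinuum.HydrodynamicLimit.Theorems.KiferCompactification

end
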